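import Literature.NumberTheory.Automorphic.GKCohomology
import Literature.NumberTheory.Automorphic.GKModulesOneParameter
import HarnessLib

/-!
# Tensor products of `(𝔤, K)`-modules; `(𝔤, K)`-cohomology with coefficients `V ⊗ W`

Topic `NumberTheory/Automorphic`; namespace `Literature.NumberTheory.Automorphic.GKTensor`.
Definitions with bodies and theorems only (no named fact, no `sorry`).

For two `(𝔤, K)`-module data `(ρK, ρ𝔤)` on `V` and `(σK, σ𝔤)` on `W` over the tree's
`G : RealMatrixGroup A N` (`GKModules`):

* `GKTensor.lie G ρ𝔤 σ𝔤 : 𝔤 →ₗ⁅ℝ⁆ End_ℂ(V ⊗_ℂ W)` — the Leibniz action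
  `X ↦ ρ𝔤 X ⊗ 1 + 1 ⊗ σ𝔤 X` (a morphism of real Lie algebras; `lie_apply_tmul`), paired with the
  diagonal `K`-action `ρK.tprod σK` (Mathlib) [cite: BorelWallach2000, I §1.3, §4.2];
* `GKTensor.isGKModule` — **the tensor product of two `(𝔤, K)`-modules is a
  `(𝔤, K)`-module** [cite: BorelWallach2000, 0 §2.5]: the four axioms of `IsGKModule` pass to
  `(ρK.tprod σK, GKTensor.lie)` — `ad_compat`, `kFinite` (the orbit span of `v ⊗ w` lies in
  `span(Kv) ⊗ span(Kw)`), `weaklyContinuous` and `hasWeakDeriv` (product rule), the last two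
  through `exists_expansion`: a `K`-finite vector expands as `x = Σᵢ ℓᵢ(x) bᵢ` uniformly on its
  `K`-orbit span with coefficients `ℓᵢ ∈ V^*` (`exists_dual_expansion`, `dual_tmul_expand`), and
  `lie_mem_kOrbitSpan` (`ρ𝔤 X v ∈ span(K v)` for `X ∈ 𝔨`, by the tree's
  `IsGKModule.apply_mem_of_expK_stable`);
* `GKTensor.cohomology G ρK ρ𝔤 σK σ𝔤 hV hW q` — **`H^q(𝔤, K; V ⊗ W)`**, the `(𝔤, K)`-cohomology
  with coefficients in the tensor product (a complex vector space, `GKCohomology`), the shape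
  `H^•(𝔤, K; π_∞ ⊗ M_λ)` in which cohomological automorphic representations are detected
  [cite: BorelWallach2000, I Thm. 5.3, II §3.1] and in which the named facts
  `bianchi_interiorEigenclass_isCuspidal`, `GLnCohomology.interiorEigenclass_isCuspidal` are
  phrased.

Not here: admissibility of the tensor product, contragredients, the Künneth rule
[cite: BorelWallach2000, I §1.3].

## References

* A. Borel, N. Wallach (2000), I §1.3, §4.2, Thm. 5.3 (held) [BorelWallach2000].
-/

noncomputable section

namespace Literature.NumberTheory.Automorphic

open TensorProduct

-- Mathlib idiom (as in `GKModules`): commutator bracket on `Module.End`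
attribute [local instance 100] LieRing.ofAssociativeRing

variable {A : Type*} [NormedCommRing A] [NormedAlgebra ℝ A] [NormedAlgebra ℚ A] [CompleteSpace A]
  [StarRing A] {N : Type*} [Fintype N] [DecidableEq N] (G : RealMatrixGroup A N)
  {V W : Type*} [AddCommGroup V] [Module ℂ V] [AddCommGroup W] [Module ℂ W]
  (ρK : Representation ℂ G.maximalCompact V) (ρ𝔤 : G.lie →ₗ⁅ℝ⁆ Module.End ℂ V)
  (σK : Representation ℂ G.maximalCompact W) (σ𝔤 : G.lie →ₗ⁅ℝ⁆ Module.End ℂ W)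

namespace GKTensor

/-- The infinitesimal tensor action `X ↦ ρ𝔤 X ⊗ 1 + 1 ⊗ σ𝔤 X` (Leibniz rule), a morphism of real
Lie algebras `𝔤 → End_ℂ(V ⊗_ℂ W)`. [cite: BorelWallach2000, I §1.3] -/
def lie : G.lie →ₗ⁅ℝ⁆ Module.End ℂ (V ⊗[ℂ] W) where
  toFun X := (ρ𝔤 X).rTensor W + (σ𝔤 X).lTensor V
  map_add' X Y := by
    simp only [map_add, LinearMap.rTensor_add, LinearMap.lTensor_add]
    abel
  map_smul' t X := by
    change (ρ𝔤 (t • X)).rTensor W + (σ𝔤 (t • X)).lTensor V =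
      t • ((ρ𝔤 X).rTensor W + (σ𝔤 X).lTensor V)
    have hV : ρ𝔤 (t • X) = (t : ℂ) • ρ𝔤 X := by rw [map_smul]; rfl
    have hW : σ𝔤 (t • X) = (t : ℂ) • σ𝔤 X := by rw [map_smul]; rfl
    have hE : ∀ F : Module.End ℂ (V ⊗[ℂ] W), t • F = (t : ℂ) • F := fun F => rfl
    rw [hV, hW, hE, LinearMap.rTensor_smul, LinearMap.lTensor_smul, smul_add]
  map_lie' {X Y} := by
    have h1 : (ρ𝔤 X).rTensor W * (σ𝔤 Y).lTensor V = (σ𝔤 Y).lTensor V * (ρ𝔤 X).rTensor W := by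
      rw [Module.End.mul_eq_comp, Module.End.mul_eq_comp, LinearMap.rTensor_comp_lTensor,
        LinearMap.lTensor_comp_rTensor]
    have h2 : (σ𝔤 X).lTensor V * (ρ𝔤 Y).rTensor W = (ρ𝔤 Y).rTensor W * (σ𝔤 X).lTensor V := by
      rw [Module.End.mul_eq_comp, Module.End.mul_eq_comp, LinearMap.rTensor_comp_lTensor,
        LinearMap.lTensor_comp_rTensor]
    simp only [LieHom.map_lie, Ring.lie_def, LinearMap.rTensor_sub, LinearMap.lTensor_sub,
      LinearMap.rTensor_mul, LinearMap.lTensor_mul, mul_add, add_mul, h1, h2]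
    abel


/-- Unfolding of the tensor action. [folklore] -/
theorem lie_apply (X : G.lie) :
    GKTensor.lie G ρ𝔤 σ𝔤 X = (ρ𝔤 X).rTensor W + (σ𝔤 X).lTensor V := rfl

/-- On pure tensors: `X • (v ⊗ w) = X v ⊗ w + v ⊗ X w`. [cite: BorelWallach2000, I §1.3] -/
theorem lie_apply_tmul (X : G.lie) (v : V) (w : W) :
    GKTensor.lie G ρ𝔤 σ𝔤 X (v ⊗ₜ w) = (ρ𝔤 X v) ⊗ₜ w + v ⊗ₜ (σ𝔤 X w) := rfl

/-- **The `(𝔤, K)`-compatibility axiom is preserved by tensor products**: if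
`ρK k ∘ ρ𝔤 X ∘ ρK k⁻¹ = ρ𝔤 (Ad k X)` and likewise for `(σK, σ𝔤)`, then the diagonal `K`-action
`ρK ⊗ σK` and the Leibniz `𝔤`-action satisfy the same axiom. [cite: BorelWallach2000, 0 §2.5] -/
theorem ad_compat
    (hV : ∀ (k : G.maximalCompact) (X : G.lie),
      ρK k ∘ₗ ρ𝔤 X ∘ₗ ρK k⁻¹ = ρ𝔤 (G.Ad (Subgroup.inclusion G.maximalCompact_le_carrier k) X))
    (hW : ∀ (k : G.maximalCompact) (X : G.lie),
      σK k ∘ₗ σ𝔤 X ∘ₗ σK k⁻¹ = σ𝔤 (G.Ad (Subgroup.inclusion G.maximalCompact_le_carrier k) X))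
    (k : G.maximalCompact) (X : G.lie) :
    ρK.tprod σK k ∘ₗ GKTensor.lie G ρ𝔤 σ𝔤 X ∘ₗ ρK.tprod σK k⁻¹ =
      GKTensor.lie G ρ𝔤 σ𝔤 (G.Ad (Subgroup.inclusion G.maximalCompact_le_carrier k) X) := by
  have hρ : (σK k).comp (σK k⁻¹) = LinearMap.id := by
    rw [← Module.End.mul_eq_comp, ← map_mul, mul_inv_cancel, map_one, Module.End.one_eq_id]
  have hρ' : (ρK k).comp (ρK k⁻¹) = LinearMap.id := by
    rw [← Module.End.mul_eq_comp, ← map_mul, mul_inv_cancel, map_one, Module.End.one_eq_id]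
  rw [Representation.tprod_apply, Representation.tprod_apply, lie_apply, lie_apply,
    LinearMap.add_comp, LinearMap.comp_add, ← hV k X, ← hW k X]
  simp only [LinearMap.rTensor, LinearMap.lTensor, ← TensorProduct.map_comp, LinearMap.id_comp,
    hρ, hρ']

/-- **`K`-finiteness is preserved by tensor products.** [cite: BorelWallach2000, 0 §2.5] -/
theorem kFinite
    (hV : ∀ v : V, FiniteDimensional ℂ
      (Submodule.span ℂ (Set.range fun k : G.maximalCompact ↦ ρK k v)))
    (hW : ∀ w : W, FiniteDimensional ℂ
      (Submodule.span ℂ (Set.range fun k : G.maximalCompact ↦ σK k w)))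
    (t : V ⊗[ℂ] W) :
    FiniteDimensional ℂ
      (Submodule.span ℂ (Set.range fun k : G.maximalCompact ↦ ρK.tprod σK k t)) := by
  induction t using TensorProduct.induction_on with
  | zero =>
    have hsub : (Set.range fun k : G.maximalCompact ↦ ρK.tprod σK k 0) ⊆ {0} := by
      rintro _ ⟨k, rfl⟩
      simp
    have hle := Submodule.span_mono (R := ℂ) hsub
    rw [Submodule.span_zero_singleton] at hle
    exact Submodule.finiteDimensional_of_le hle
  | tmul v w =>
    set Pv := Submodule.span ℂ (Set.range fun k : G.maximalCompact ↦ ρK k v)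
    set Pw := Submodule.span ℂ (Set.range fun k : G.maximalCompact ↦ σK k w)
    haveI := hV v
    haveI := hW w
    have hle : Submodule.span ℂ (Set.range fun k : G.maximalCompact ↦ ρK.tprod σK k (v ⊗ₜ w)) ≤
        LinearMap.range (TensorProduct.map Pv.subtype Pw.subtype) := by
      rw [Submodule.span_le]
      rintro _ ⟨k, rfl⟩
      refine ⟨⟨ρK k v, Submodule.subset_span ⟨k, rfl⟩⟩ ⊗ₜ ⟨σK k w, Submodule.subset_span ⟨k, rfl⟩⟩,
        ?_⟩
      simp [Representation.tprod_apply, TensorProduct.map_tmul]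
    exact Submodule.finiteDimensional_of_le hle
  | add t₁ t₂ h₁ h₂ =>
    have hle : Submodule.span ℂ (Set.range fun k : G.maximalCompact ↦ ρK.tprod σK k (t₁ + t₂)) ≤
        Submodule.span ℂ (Set.range fun k : G.maximalCompact ↦ ρK.tprod σK k t₁) ⊔
          Submodule.span ℂ (Set.range fun k : G.maximalCompact ↦ ρK.tprod σK k t₂) := by
      rw [Submodule.span_le]
      rintro _ ⟨k, rfl⟩
      dsimp only
      rw [map_add]
      exact Submodule.add_mem_sup (Submodule.subset_span ⟨k, rfl⟩) (Submodule.subset_span ⟨k, rfl⟩)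
    exact Submodule.finiteDimensional_of_le hle

/-- Elements of a finite-dimensional subspace expand in a fixed finite family with coefficients
given by linear functionals on the ambient space: `x = Σᵢ ℓᵢ(x) • bᵢ` for `x ∈ P`. [folklore] -/
theorem exists_dual_expansion {V : Type*} [AddCommGroup V] [Module ℂ V]
    (P : Submodule ℂ V) [FiniteDimensional ℂ P] :
    ∃ (n : ℕ) (b : Fin n → V) (ℓ : Fin n → Module.Dual ℂ V),
      ∀ x ∈ P, x = ∑ i, ℓ i x • b i := by
  let bP := Module.finBasis ℂ P
  let r := P.subtype.leftInverse
  refine ⟨_, fun i => (bP i : V), fun i => (bP.coord i).comp r, fun x hx => ?_⟩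
  have hr : r x = ⟨x, hx⟩ := LinearMap.leftInverse_apply_of_inj (Submodule.ker_subtype P) ⟨x, hx⟩
  conv_lhs => rw [show x = ((⟨x, hx⟩ : P) : V) from rfl, ← bP.sum_repr ⟨x, hx⟩]
  rw [Submodule.coe_sum]
  refine Finset.sum_congr rfl fun i _ => ?_
  rw [Submodule.coe_smul, LinearMap.comp_apply, hr]
  rfl

/-- The `K`-orbit span of a vector is `K`-stable. [folklore] -/
theorem kOrbitSpan_stable (v : V) (k : G.maximalCompact) {u : V}
    (hu : u ∈ Submodule.span ℂ (Set.range fun k : G.maximalCompact ↦ ρK k v)) :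
    ρK k u ∈ Submodule.span ℂ (Set.range fun k : G.maximalCompact ↦ ρK k v) := by
  induction hu using Submodule.span_induction with
  | mem x hx =>
    obtain ⟨k', rfl⟩ := hx
    refine Submodule.subset_span ⟨k * k', ?_⟩
    simp only [map_mul, Module.End.mul_apply]
  | zero => simp
  | add x y _ _ hx hy =>
    rw [map_add]
    exact Submodule.add_mem _ hx hy
  | smul c x _ hx =>
    rw [map_smul]
    exact Submodule.smul_mem _ c hx

/-- A `K`-finite vector expands in a fixed finite family with coefficients that are linear
functionals, uniformly over its `K`-orbit span: `x = Σᵢ ℓᵢ(x) • bᵢ` for `x ∈ span(K v)` (in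
particular for `x = ρK k v`). [folklore] -/
theorem exists_expansion (v : V)
    (hv : FiniteDimensional ℂ (Submodule.span ℂ (Set.range fun k : G.maximalCompact ↦ ρK k v))) :
    ∃ (n : ℕ) (b : Fin n → V) (ℓ : Fin n → Module.Dual ℂ V),
      ∀ x ∈ Submodule.span ℂ (Set.range fun k : G.maximalCompact ↦ ρK k v),
        x = ∑ i, ℓ i x • b i :=
  exists_dual_expansion _

omit [NormedAlgebra ℚ A] [CompleteSpace A] [StarRing A] [Fintype N] [DecidableEq N] in
/-- Bilinear expansion: if `x = Σᵢ ℓᵢ(x) bᵢ` and `y = Σⱼ μⱼ(y) cⱼ` then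
`L(x ⊗ y) = Σᵢⱼ ℓᵢ(x) μⱼ(y) L(bᵢ ⊗ cⱼ)`. [folklore] -/
theorem dual_tmul_expand {n m : ℕ} (b : Fin n → V) (ℓ : Fin n → Module.Dual ℂ V) (c : Fin m → W)
    (μ : Fin m → Module.Dual ℂ W) (L : Module.Dual ℂ (V ⊗[ℂ] W)) {x : V} {y : W}
    (hx : x = ∑ i, ℓ i x • b i) (hy : y = ∑ j, μ j y • c j) :
    L (x ⊗ₜ y) = ∑ i, ∑ j, ℓ i x * μ j y * L (b i ⊗ₜ c j) := by
  conv_lhs => rw [hx, hy]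
  rw [TensorProduct.sum_tmul]
  simp_rw [TensorProduct.tmul_sum, ← TensorProduct.smul_tmul', TensorProduct.tmul_smul,
    smul_smul, map_sum, map_smul, smul_eq_mul]

/-- **Weak continuity is preserved by tensor products** (given `K`-finiteness).
[cite: BorelWallach2000, 0 §2.5] -/
theorem weaklyContinuous
    (hVf : ∀ v : V, FiniteDimensional ℂ
      (Submodule.span ℂ (Set.range fun k : G.maximalCompact ↦ ρK k v)))
    (hWf : ∀ w : W, FiniteDimensional ℂ
      (Submodule.span ℂ (Set.range fun k : G.maximalCompact ↦ σK k w)))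
    (hV : ∀ (v : V) (ℓ : Module.Dual ℂ V), Continuous fun k : G.maximalCompact ↦ ℓ (ρK k v))
    (hW : ∀ (w : W) (ℓ : Module.Dual ℂ W), Continuous fun k : G.maximalCompact ↦ ℓ (σK k w))
    (t : V ⊗[ℂ] W) (L : Module.Dual ℂ (V ⊗[ℂ] W)) :
    Continuous fun k : G.maximalCompact ↦ L (ρK.tprod σK k t) := by
  induction t using TensorProduct.induction_on with
  | zero => simpa only [map_zero] using continuous_const
  | tmul v w =>
    obtain ⟨n, b, ℓ, hb⟩ := exists_expansion G ρK v (hVf v)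
    obtain ⟨m, c, μ, hc⟩ := exists_expansion G σK w (hWf w)
    have key : ∀ k : G.maximalCompact, L (ρK.tprod σK k (v ⊗ₜ w)) =
        ∑ i, ∑ j, ℓ i (ρK k v) * μ j (σK k w) * L (b i ⊗ₜ c j) := fun k =>
      dual_tmul_expand b ℓ c μ L (hb _ (Submodule.subset_span ⟨k, rfl⟩))
        (hc _ (Submodule.subset_span ⟨k, rfl⟩))
    simp_rw [key]
    exact continuous_finsetSum _ fun i _ => continuous_finsetSum _ fun j _ =>
      (((hV v (ℓ i)).mul (hW w (μ j))).mul continuous_const)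
  | add t₁ t₂ h₁ h₂ =>
    simp only [map_add]
    exact h₁.add h₂

section Deriv

variable [StarModule ℝ A] [ContinuousStar A]

/-- In a `(𝔤, K)`-module, `ρ𝔤 X v` lies in the (finite-dimensional, `K`-stable) `K`-orbit span of
`v` for `X ∈ 𝔨` (the span is `exp t X`-stable, hence `ρ𝔤 X`-stable). [folklore] -/
theorem lie_mem_kOrbitSpan (h : IsGKModule G ρK ρ𝔤) (X : G.compactLie) (v : V) :
    ρ𝔤 (LieSubalgebra.inclusion G.compactLie_le_lie X) v ∈
      Submodule.span ℂ (Set.range fun k : G.maximalCompact ↦ ρK k v) :=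
  h.apply_mem_of_expK_stable X (fun _ _ hu => kOrbitSpan_stable G ρK v _ hu)
    (Submodule.subset_span ⟨1, by simp only [map_one, Module.End.one_apply]⟩)

/-- **The derivative axiom is preserved by tensor products**: for `X ∈ 𝔨`,
`d/dt|₀ L(ρK(e^{tX}) v ⊗ σK(e^{tX}) w) = L(ρ𝔤 X v ⊗ w + v ⊗ σ𝔤 X w)` (product rule inside the
finite-dimensional space `span(K v) ⊗ span(K w)`). [cite: BorelWallach2000, 0 §2.5] -/
theorem hasWeakDeriv (hV : IsGKModule G ρK ρ𝔤) (hW : IsGKModule G σK σ𝔤) (X : G.compactLie)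
    (t : V ⊗[ℂ] W) (L : Module.Dual ℂ (V ⊗[ℂ] W)) :
    HasDerivAt (fun s : ℝ ↦ L (ρK.tprod σK (G.expK (s • X)) t))
      (L (GKTensor.lie G ρ𝔤 σ𝔤 (LieSubalgebra.inclusion G.compactLie_le_lie X) t)) 0 := by
  induction t using TensorProduct.induction_on with
  | zero =>
    simp only [map_zero]
    exact hasDerivAt_const 0 0
  | add t₁ t₂ h₁ h₂ =>
    simp only [map_add]
    exact h₁.add h₂
  | tmul v w =>
    set X' := LieSubalgebra.inclusion G.compactLie_le_lie X
    obtain ⟨n, b, ℓ, hb⟩ := exists_expansion G ρK v (hV.kFinite v)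
    obtain ⟨m, c, μ, hc⟩ := exists_expansion G σK w (hW.kFinite w)
    have hv1 : v ∈ Submodule.span ℂ (Set.range fun k : G.maximalCompact ↦ ρK k v) :=
      Submodule.subset_span ⟨1, by simp only [map_one, Module.End.one_apply]⟩
    have hw1 : w ∈ Submodule.span ℂ (Set.range fun k : G.maximalCompact ↦ σK k w) :=
      Submodule.subset_span ⟨1, by simp only [map_one, Module.End.one_apply]⟩
    have key : ∀ s : ℝ, L (ρK.tprod σK (G.expK (s • X)) (v ⊗ₜ w)) =
        ∑ i, ∑ j, ℓ i (ρK (G.expK (s • X)) v) * μ j (σK (G.expK (s • X)) w) * L (b i ⊗ₜ c j) :=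
      fun s => dual_tmul_expand b ℓ c μ L (hb _ (Submodule.subset_span ⟨_, rfl⟩))
        (hc _ (Submodule.subset_span ⟨_, rfl⟩))
    have hd : HasDerivAt (fun s : ℝ ↦
        ∑ i, ∑ j, ℓ i (ρK (G.expK (s • X)) v) * μ j (σK (G.expK (s • X)) w) * L (b i ⊗ₜ c j))
        (∑ i, ∑ j, (ℓ i (ρ𝔤 X' v) * μ j w + ℓ i v * μ j (σ𝔤 X' w)) * L (b i ⊗ₜ c j)) 0 := by
      refine HasDerivAt.fun_sum fun i _ => HasDerivAt.fun_sum fun j _ => ?_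
      have h12 := ((hV.hasWeakDeriv X v (ℓ i)).mul (hW.hasWeakDeriv X w (μ j))).mul_const
        (L (b i ⊗ₜ c j))
      simp only [RealMatrixGroup.expK_zero_smul, map_one, Module.End.one_apply] at h12
      exact h12
    rw [show (fun s : ℝ ↦ L (ρK.tprod σK (G.expK (s • X)) (v ⊗ₜ w))) = _ from funext key]
    convert hd using 1
    rw [lie_apply_tmul, map_add,
      dual_tmul_expand b ℓ c μ L (hb _ (lie_mem_kOrbitSpan G ρK ρ𝔤 hV X v)) (hc _ hw1),
      dual_tmul_expand b ℓ c μ L (hb _ hv1) (hc _ (lie_mem_kOrbitSpan G σK σ𝔤 hW X w)),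
      ← Finset.sum_add_distrib]
    refine Finset.sum_congr rfl fun i _ => ?_
    rw [← Finset.sum_add_distrib]
    refine Finset.sum_congr rfl fun j _ => ?_
    ring

/-- **The tensor product of two `(𝔤, K)`-modules is a `(𝔤, K)`-module** (diagonal `K`-action,
Leibniz `𝔤`-action). [cite: BorelWallach2000, 0 §2.5] -/
theorem isGKModule (hV : IsGKModule G ρK ρ𝔤) (hW : IsGKModule G σK σ𝔤) :
    IsGKModule G (ρK.tprod σK) (GKTensor.lie G ρ𝔤 σ𝔤) where
  kFinite := kFinite G ρK σK hV.kFinite hW.kFinite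
  weaklyContinuous := weaklyContinuous G ρK σK hV.kFinite hW.kFinite hV.weaklyContinuous
    hW.weaklyContinuous
  ad_compat := ad_compat G ρK ρ𝔤 σK σ𝔤 hV.ad_compat hW.ad_compat
  hasWeakDeriv := hasWeakDeriv G ρK ρ𝔤 σK σ𝔤 hV hW

end Deriv



/-! ### `(𝔤, K)`-cohomology with coefficients `V ⊗ W` -/

variable [StarModule ℝ A]

/-- **`H^q(𝔤, K; V ⊗ W)`**: the `(𝔤, K)`-cohomology with coefficients in the tensor product of two
`(𝔤, K)`-module data (diagonal `K`-action, Leibniz `𝔤`-action), a complex vector space.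
[cite: BorelWallach2000, I §5.1 (4), §4.2] -/
abbrev cohomology
    (hV : ∀ (k : G.maximalCompact) (X : G.lie),
      ρK k ∘ₗ ρ𝔤 X ∘ₗ ρK k⁻¹ = ρ𝔤 (G.Ad (Subgroup.inclusion G.maximalCompact_le_carrier k) X))
    (hW : ∀ (k : G.maximalCompact) (X : G.lie),
      σK k ∘ₗ σ𝔤 X ∘ₗ σK k⁻¹ = σ𝔤 (G.Ad (Subgroup.inclusion G.maximalCompact_le_carrier k) X))
    (q : ℕ) : Type _ :=
  gkCohomology G (ρK.tprod σK) (GKTensor.lie G ρ𝔤 σ𝔤) (GKTensor.ad_compat G ρK ρ𝔤 σK σ𝔤 hV hW) q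

example
    (hV : ∀ (k : G.maximalCompact) (X : G.lie),
      ρK k ∘ₗ ρ𝔤 X ∘ₗ ρK k⁻¹ = ρ𝔤 (G.Ad (Subgroup.inclusion G.maximalCompact_le_carrier k) X))
    (hW : ∀ (k : G.maximalCompact) (X : G.lie),
      σK k ∘ₗ σ𝔤 X ∘ₗ σK k⁻¹ = σ𝔤 (G.Ad (Subgroup.inclusion G.maximalCompact_le_carrier k) X))
    (q : ℕ) : Module ℂ (cohomology G ρK ρ𝔤 σK σ𝔤 hV hW q) := inferInstance

end GKTensor

end Literature.NumberTheory.Automorphic
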